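import Mathlib
import Literature.NumberTheory.Transcendental.AssociatorsEvalProofs
import HarnessLib

/-!
# The completed shuffle algebra, its elementary derivations, and the Taylor (constant-term) maps

Definitions-and-proofs file (Literature, `NumberTheory/Transcendental`), written for the proof of
the named fact `drinfeldAssociator_isGroupLike` (`DrinfeldAssociator.lean`: the Drinfeld
associator, defined coefficientwise by Furusho's formula `c_W = (-1)^{dp W} Z(reg W)`
[Furusho2003, Prop. 3.2.3], is group-like). Coefficientwise, group-likeness of `Φ_KZ` is the
system of REGULARISED shuffle relations of multiple zeta values, and — once the shuffle relation of
convergent MZVs is known (`multipleZeta_mul_eq_sum_shuffleWord`, `MZVWordShuffleProofs.lean`) — it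
reduces to the algebraic statement that IKZ's shuffle regularisation
`reg : ℚ⟨x,y⟩ → 𝔥⁰` [IharaKanekoZagier2006, §3], which the tree DEFINES by the explicit formula of
[IharaKanekoZagier2006, Cor. 5] (`MZV.shuffleReg`, `MZVShuffleRegularisation.lean`), is a
homomorphism for the shuffle product `ш` with values in `𝔥⁰`. In [IharaKanekoZagier2006] `reg_ш`
is a `ш`-homomorphism by definition (through `𝔥¹_ш = 𝔥⁰_ш[y]`, Prop. 1 with [Reutenauer1993]) and
Cor. 5 is the theorem; here the roles are reversed, and this file supplies the algebra proving that
the Cor. 5 formula is multiplicative. Everything is proved; no named fact is introduced.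

## Contents

1. `ShuffleAlgebra α R` — the **completed shuffle algebra**: all functions `List α → R` (a
   structure with a `FunLike` coercion), coefficientwise addition, and the shuffle product computed
   through the deshuffles of `AssociatorsEvalProofs.lean`,
   `(f ш g)(w) = Σ_{(u,u') ∈ deshuffle w} f(u) g(u')` (`ShuffleAlgebra.mul_apply`) — the algebra dual
   to the letter-primitive coproduct `Δ`, i.e. the completion of the shuffle algebra `R⟨α⟩_ш`
   [Reutenauer1993, §1.4]. It is a commutative ring (`ShuffleAlgebra.instCommRing`; associativity
   is coassociativity of deshuffling, `sum_deshuffle_deshuffle`), words `word w` multiply by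
   `u ш v = Σ_{w ∈ u ш v} w` with the tree's `MZV.shuffleWord` (`word_mul_word`), constants `C r`
   act as scalars, and powers of a letter are divided powers: `aⁱ ш aʲ = binom(i+j,i) aⁱ⁺ʲ`
   (`word_replicate_mul_word_replicate`).
2. The two elementary **derivations** `dEnd a` ("remove the final letter if it is `a`",
   `(∂ₐ f)(w) = f(w a)`) and `dFront b` (`(ᵦ∂ f)(w) = f(b w)`), with the Leibniz rule
   (`dEnd_mul`, `dFront_mul`: the last/first letter of a shuffle comes from one of the factors).
3. `TaylorSystem A` — a derivation `D` with divided powers `t k` on a commutative ring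
   (`tᵢ tⱼ = binom(i+j,i) tᵢ₊ⱼ`, `D tₖ₊₁ = tₖ`) and its **Taylor (constant-term) maps**
   `τ_N(f) = Σ_{k<N} (-1)ᵏ tₖ Dᵏ f` (`TaylorSystem.taylor`): on `D`-nilpotent elements they are
   multiplicative (`taylor_mul`, via the general Leibniz rule `iterate_mul`), kill `D`
   (`D_taylor`), fix `ker D` (`taylor_of_D_eq_zero`) and are `ker D`-linear
   (`taylor_mul_left_of_D_eq_zero`). With `D = ∂ₓ`, `tₖ = xᵏ` (`endSystem`) resp. `D = ᵧ∂`,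
   `tₖ = yᵏ` (`frontSystem`) these are exactly the two one-sided regularisation formulas
   `Σ_k (-1)ᵏ xᵏ ш (w minus its last k letters)`, `Σ_i (-1)ⁱ yⁱ ш (w minus its first i letters)`
   of [IharaKanekoZagier2006, Cor. 5] (`MZV.regEnd`, `MZV.regFront`; the identification is in
   `MZVShuffleRegularisationProofs.lean`).
4. For binary words (`false = x`, `true = y`): `regE w`, `regF w` and the two-sided
   `reg w = τ^{front}(τ^{end}(w))`, with **`reg` multiplicative** (`reg_mul`:
   `Σ_{w ∈ u ш v} reg w = reg u ш reg v`) and **`reg` killing every word ending in `x` or beginning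
   with `y`** (`reg_apply_append_false`, `reg_apply_cons_true`), i.e. `reg` lands in `𝔥⁰`.

## Design notes

* `ShuffleAlgebra` is a one-field structure rather than a type synonym of `List α → R`, so that
  the pointwise product is not picked up and `simp` can rewrite under evaluations.
* No finiteness of supports is needed anywhere: the product is a finite sum for each word, and the
  Taylor maps are used with an explicit truncation `N` above the nilpotency index
  (`taylor_eq_of_le` shows the choice is immaterial).
* Mathlib (checked 2026-08-15): no shuffle algebra / shuffle product of words, no general Leibniz
  formula for iterates of a derivation on a ring (`LieDerivation.iterate_apply_lie` is the Lie
  version whose proof pattern `Finset.sum_antidiagonal_choose_succ_nsmul` is reused here).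

## Deliberately NOT here

The Hopf-algebra structure (deconcatenation coproduct, antipode), Radford's theorem (the shuffle
algebra is free on Lyndon words) and `𝔥_ш = 𝔥⁰_ш[x,y]` [Reutenauer1993, §6]; the identification with
`MZV.shuffleReg` and the MZV consequences (sibling proof files
`MZVShuffleRegularisationProofs.lean`, `DrinfeldAssociatorProofs.lean`).

## References

* C. Reutenauer, *Free Lie Algebras*, London Math. Soc. Monographs 7, Oxford (1993), §1.4 (shuffle
  product, duality with the coproduct), §6. [Reutenauer1993]
* K. Ihara, M. Kaneko, D. Zagier, *Derivation and double shuffle relations for multiple zeta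
  values*, Compositio Math. 142 (2006), 307–338, §2 Prop. 1, §3 p. 314 (`reg_ш`), Cor. 5 p. 322
  (explicit regularisation formula). [IharaKanekoZagier2006]
* H. Furusho, *The multiple zeta value algebra and the stable derivation algebra*, Publ. RIMS 39
  (2003), Prop. 3.2.3. [Furusho2003]
-/

noncomputable section

open scoped BigOperators

namespace Literature.NumberTheory.Transcendental

universe u v

/-- The **completed shuffle algebra** over the alphabet `α` with coefficients in `R`: all functions
`f : List α → R` on words ("`Σ_w f(w) w`", infinite sums allowed), with coefficientwise addition and
the shuffle product computed through deshuffles,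
`(f ш g)(w) = Σ_{(u,u') ∈ deshuffle w} f(u) g(u')` (`ShuffleAlgebra.mul_apply`), so that on words
`u ш v = Σ_{w ∈ u ш v} w` (`ShuffleAlgebra.word_mul_word`, by the transposition
`NCSeries.count_deshuffle`). It is the linear dual of the coalgebra `(R⟨α⟩, Δ)`, `Δ` the
letter-primitive coproduct, hence a commutative ring containing the shuffle algebra
`R⟨α⟩_ш` [Reutenauer1993, §1.4] as the subring of finitely supported functions. Wrapped in a
structure (with a `FunLike` coercion to functions) so that the pointwise product of functions is
not picked up. [cite: Reutenauer1993, §1.4] -/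
structure ShuffleAlgebra (α : Type u) (R : Type v) : Type (max u v) where
  /-- The coefficient function `w ↦ f(w)`. -/
  coeff : List α → R

namespace ShuffleAlgebra

variable {α : Type u} {R : Type v}

/-- Elements of the completed shuffle algebra are functions on words. [folklore] -/
instance instFunLike : FunLike (ShuffleAlgebra α R) (List α) R where
  coe := ShuffleAlgebra.coeff
  coe_injective := by
    rintro ⟨f⟩ ⟨g⟩ h
    congr

/-- Two elements are equal iff all their coefficients are. [folklore] -/
@[ext] theorem ext {f g : ShuffleAlgebra α R} (h : ∀ w, f w = g w) : f = g := DFunLike.ext _ _ h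

/-- The coefficients of `⟨f⟩` are `f`. [folklore] -/
@[simp] theorem mk_apply (f : List α → R) (w : List α) : (⟨f⟩ : ShuffleAlgebra α R) w = f w := rfl

section AddCommGroup

variable [AddCommGroup R]

/-- Coefficientwise zero. [folklore] -/
instance instZero : Zero (ShuffleAlgebra α R) := ⟨⟨0⟩⟩
/-- Coefficientwise addition. [folklore] -/
instance instAdd : Add (ShuffleAlgebra α R) := ⟨fun f g => ⟨fun w => f w + g w⟩⟩
/-- Coefficientwise negation. [folklore] -/
instance instNeg : Neg (ShuffleAlgebra α R) := ⟨fun f => ⟨fun w => -f w⟩⟩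
/-- Coefficientwise subtraction. [folklore] -/
instance instSub : Sub (ShuffleAlgebra α R) := ⟨fun f g => ⟨fun w => f w - g w⟩⟩
/-- Coefficientwise `ℕ`-multiples. [folklore] -/
instance instSMulNat : SMul ℕ (ShuffleAlgebra α R) := ⟨fun n f => ⟨fun w => n • f w⟩⟩
/-- Coefficientwise `ℤ`-multiples. [folklore] -/
instance instSMulInt : SMul ℤ (ShuffleAlgebra α R) := ⟨fun n f => ⟨fun w => n • f w⟩⟩

/-- Coefficientwise additive group structure. [folklore] -/
instance instAddCommGroup : AddCommGroup (ShuffleAlgebra α R) :=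
  DFunLike.coe_injective.addCommGroup _ rfl (fun _ _ => rfl) (fun _ => rfl) (fun _ _ => rfl)
    (fun _ _ => rfl) (fun _ _ => rfl)

/-- `(0)(w) = 0`. [folklore] -/
@[simp] theorem zero_apply (w : List α) : (0 : ShuffleAlgebra α R) w = 0 := rfl

/-- `(f + g)(w) = f(w) + g(w)`. [folklore] -/
@[simp] theorem add_apply (f g : ShuffleAlgebra α R) (w : List α) : (f + g) w = f w + g w := rfl

/-- `(-f)(w) = -f(w)`. [folklore] -/
@[simp] theorem neg_apply (f : ShuffleAlgebra α R) (w : List α) : (-f) w = -f w := rfl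

/-- `(f - g)(w) = f(w) - g(w)`. [folklore] -/
@[simp] theorem sub_apply (f g : ShuffleAlgebra α R) (w : List α) : (f - g) w = f w - g w := rfl

/-- A list sum of elements, evaluated at a word. [folklore] -/
theorem list_sum_apply (L : List (ShuffleAlgebra α R)) (w : List α) :
    L.sum w = (L.map fun f => f w).sum := by
  induction L with
  | nil => rfl
  | cons f L ih => rw [List.sum_cons, List.map_cons, List.sum_cons, add_apply, ih]

/-- A finite sum of elements, evaluated at a word. [folklore] -/
theorem finset_sum_apply {ι : Type*} (s : Finset ι) (f : ι → ShuffleAlgebra α R) (w : List α) :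
    (∑ i ∈ s, f i) w = ∑ i ∈ s, f i w := by
  classical
  induction s using Finset.induction_on with
  | empty => rfl
  | insert i s hi ih => rw [Finset.sum_insert hi, Finset.sum_insert hi, add_apply, ih]

end AddCommGroup

section Ring

variable [CommRing R]

open NCSeries (deshuffle deshuffle_nil deshuffle_cons)

/-- **The shuffle product**, through deshuffles: `(f ш g)(w) = Σ_{(u,u') ∈ deshuffle w} f(u) g(u')`
(the convolution dual to the coproduct `Δ`, [Reutenauer1993, §1.4]). [cite: Reutenauer1993, §1.4] -/
instance instMul : Mul (ShuffleAlgebra α R) :=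
  ⟨fun f g => ⟨fun w => ((deshuffle w).map fun p => f p.1 * g p.2).sum⟩⟩

/-- `(f ш g)(w) = Σ_{(u,u') ∈ deshuffle w} f(u) g(u')`. [cite: Reutenauer1993, §1.4] -/
theorem mul_apply (f g : ShuffleAlgebra α R) (w : List α) :
    (f * g) w = ((deshuffle w).map fun p => f p.1 * g p.2).sum := rfl

/-- The unit: the empty word (coefficient `1` on `[]`, `0` elsewhere). [folklore] -/
instance instOne : One (ShuffleAlgebra α R) :=
  ⟨⟨fun w => match w with
    | [] => 1
    | _ :: _ => 0⟩⟩

/-- `1([]) = 1`. [folklore] -/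
@[simp] theorem one_apply_nil : (1 : ShuffleAlgebra α R) [] = 1 := rfl

/-- `1(a w) = 0`. [folklore] -/
@[simp] theorem one_apply_cons (a : α) (w : List α) : (1 : ShuffleAlgebra α R) (a :: w) = 0 := rfl

/-- Swapping the two halves of the deshuffles permutes them: summed form. [folklore] -/
theorem sum_deshuffle_swap {M : Type*} [AddCommMonoid M] :
    ∀ (F : List α → List α → M) (w : List α),
      ((deshuffle w).map fun p => F p.1 p.2).sum = ((deshuffle w).map fun p => F p.2 p.1).sum
  | F, [] => by simp
  | F, x :: w => by
    simp only [deshuffle_cons, List.map_append, List.map_map, Function.comp_def, List.sum_append]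
    rw [sum_deshuffle_swap (fun u u' => F (x :: u) u') w,
      sum_deshuffle_swap (fun u u' => F u (x :: u')) w, add_comm]

/-- **Coassociativity of deshuffling**, summed form: splitting `w` into `(u, r)` and then `r` into
`(u', u'')` enumerates the same triples as splitting `w` into `(l, u'')` and then `l` into
`(u, u')`. [folklore] -/
theorem sum_deshuffle_deshuffle {M : Type*} [AddCommMonoid M] :
    ∀ (F : List α → List α → List α → M) (w : List α),
      ((deshuffle w).map fun p => ((deshuffle p.2).map fun q => F p.1 q.1 q.2).sum).sum =
        ((deshuffle w).map fun p => ((deshuffle p.1).map fun q => F q.1 q.2 p.2).sum).sum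
  | F, [] => by simp
  | F, x :: w => by
    simp only [deshuffle_cons, List.map_append, List.map_map, Function.comp_def, List.sum_append,
      List.sum_map_add]
    rw [sum_deshuffle_deshuffle (fun a b c => F (x :: a) b c) w,
      sum_deshuffle_deshuffle (fun a b c => F a (x :: b) c) w,
      sum_deshuffle_deshuffle (fun a b c => F a b (x :: c)) w]
    abel

/-- Only the deshuffle `([], w)` has empty first half: summed form. [folklore] -/
theorem sum_deshuffle_one_mul (f : List α → R) :
    ∀ w : List α, ((deshuffle w).map fun p => (1 : ShuffleAlgebra α R) p.1 * f p.2).sum = f w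
  | [] => by simp
  | x :: w => by
    simp only [deshuffle_cons, List.map_append, List.map_map, Function.comp_def, List.sum_append,
      one_apply_cons, zero_mul, List.map_const', List.sum_replicate, smul_zero, zero_add]
    exact sum_deshuffle_one_mul (fun v => f (x :: v)) w

/-- `1 ш f = f`. [folklore] -/
protected theorem one_mul (f : ShuffleAlgebra α R) : (1 : ShuffleAlgebra α R) * f = f := by
  ext w; exact sum_deshuffle_one_mul f w

/-- `f ш g = g ш f`: the shuffle product is commutative. [cite: Reutenauer1993, §1.4] -/
protected theorem mul_comm (f g : ShuffleAlgebra α R) : f * g = g * f := by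
  ext w
  rw [mul_apply, mul_apply, sum_deshuffle_swap (fun u u' => f u * g u') w]
  exact congrArg List.sum (List.map_congr_left fun p _ => mul_comm _ _)

/-- `f ш 1 = f`. [folklore] -/
protected theorem mul_one (f : ShuffleAlgebra α R) : f * (1 : ShuffleAlgebra α R) = f := by
  rw [ShuffleAlgebra.mul_comm]; exact ShuffleAlgebra.one_mul f

/-- The shuffle product is associative. [cite: Reutenauer1993, §1.4] -/
protected theorem mul_assoc (f g h : ShuffleAlgebra α R) : f * g * h = f * (g * h) := by
  ext w
  simp only [mul_apply]
  have e1 : ((deshuffle w).map fun p =>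
        ((deshuffle p.1).map fun q => f q.1 * g q.2).sum * h p.2).sum =
      ((deshuffle w).map fun p =>
        ((deshuffle p.1).map fun q => f q.1 * g q.2 * h p.2).sum).sum :=
    congrArg List.sum (List.map_congr_left fun p _ => by rw [← List.sum_map_mul_right])
  have e2 : ((deshuffle w).map fun p =>
        f p.1 * ((deshuffle p.2).map fun q => g q.1 * h q.2).sum).sum =
      ((deshuffle w).map fun p =>
        ((deshuffle p.2).map fun q => f p.1 * g q.1 * h q.2).sum).sum :=
    congrArg List.sum (List.map_congr_left fun p _ => by
      rw [← List.sum_map_mul_left]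
      exact congrArg List.sum (List.map_congr_left fun q _ => by rw [mul_assoc]))
  rw [e1, e2, sum_deshuffle_deshuffle (fun a b c => f a * g b * h c) w]

/-- `0 ш f = 0`. [folklore] -/
protected theorem zero_mul (f : ShuffleAlgebra α R) : (0 : ShuffleAlgebra α R) * f = 0 := by
  ext w; simp [mul_apply]

/-- `f ш 0 = 0`. [folklore] -/
protected theorem mul_zero (f : ShuffleAlgebra α R) : f * (0 : ShuffleAlgebra α R) = 0 := by
  ext w; simp [mul_apply]

/-- Left distributivity. [folklore] -/
protected theorem mul_add (f g h : ShuffleAlgebra α R) : f * (g + h) = f * g + f * h := by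
  ext w; simp only [mul_apply, add_apply, mul_add, List.sum_map_add]

/-- Right distributivity. [folklore] -/
protected theorem add_mul (f g h : ShuffleAlgebra α R) : (f + g) * h = f * h + g * h := by
  ext w; simp only [mul_apply, add_apply, add_mul, List.sum_map_add]

/-- **The completed shuffle algebra is a commutative ring.** [cite: Reutenauer1993, §1.4] -/
instance instCommRing : CommRing (ShuffleAlgebra α R) where
  __ := (inferInstance : AddCommGroup (ShuffleAlgebra α R))
  zero_mul := ShuffleAlgebra.zero_mul
  mul_zero := ShuffleAlgebra.mul_zero
  one_mul := ShuffleAlgebra.one_mul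
  mul_one := ShuffleAlgebra.mul_one
  mul_assoc := ShuffleAlgebra.mul_assoc
  mul_comm := ShuffleAlgebra.mul_comm
  left_distrib := ShuffleAlgebra.mul_add
  right_distrib := ShuffleAlgebra.add_mul


/-! ### Constants -/

/-- The constant `r` (coefficient `r` on the empty word). [folklore] -/
def C (r : R) : ShuffleAlgebra α R :=
  ⟨fun w => match w with
    | [] => r
    | _ :: _ => 0⟩

/-- `C r ([]) = r`. [folklore] -/
@[simp] theorem C_apply_nil (r : R) : (C r : ShuffleAlgebra α R) [] = r := rfl

/-- `C r (a w) = 0`. [folklore] -/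
@[simp] theorem C_apply_cons (r : R) (a : α) (w : List α) :
    (C r : ShuffleAlgebra α R) (a :: w) = 0 := rfl

/-- `C 1 = 1`. [folklore] -/
theorem C_one : (C 1 : ShuffleAlgebra α R) = 1 := by
  ext w; cases w <;> rfl

/-- Only the deshuffle `([], w)` has empty first half: `(C r ш f)(w) = r f(w)`. [folklore] -/
theorem sum_deshuffle_C_mul (r : R) (f : List α → R) :
    ∀ w : List α, ((deshuffle w).map fun p => (C r : ShuffleAlgebra α R) p.1 * f p.2).sum = r * f w
  | [] => by simp
  | x :: w => by
    simp only [deshuffle_cons, List.map_append, List.map_map, Function.comp_def, List.sum_append,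
      C_apply_cons, zero_mul, List.map_const', List.sum_replicate, smul_zero, zero_add]
    exact sum_deshuffle_C_mul r (fun v => f (x :: v)) w

/-- `(C r ш f)(w) = r f(w)`: constants act as scalars. [folklore] -/
@[simp] theorem C_mul_apply (r : R) (f : ShuffleAlgebra α R) (w : List α) :
    (C r * f : ShuffleAlgebra α R) w = r * f w :=
  sum_deshuffle_C_mul r f w

/-- `C (r s) = C r ш C s`. [folklore] -/
theorem C_mul (r s : R) : (C (r * s) : ShuffleAlgebra α R) = C r * C s := by
  ext w; rw [C_mul_apply]; cases w <;> simp

/-! ### The two elementary derivations: removing a final / an initial letter -/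

/-- Deshuffles of `w a`: the final letter `a` goes to one half or to the other (summed form).
[folklore] -/
theorem sum_deshuffle_append_singleton {M : Type*} [AddCommMonoid M] (a : α) :
    ∀ (F : List α → List α → M) (w : List α),
      ((deshuffle (w ++ [a])).map fun p => F p.1 p.2).sum =
        ((deshuffle w).map fun p => F (p.1 ++ [a]) p.2).sum +
          ((deshuffle w).map fun p => F p.1 (p.2 ++ [a])).sum
  | F, [] => by simp [deshuffle_cons]
  | F, x :: w => by
    rw [List.cons_append]
    simp only [deshuffle_cons, List.map_append, List.map_map, Function.comp_def, List.sum_append,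
      List.cons_append]
    rw [sum_deshuffle_append_singleton a (fun p₁ p₂ => F (x :: p₁) p₂) w,
      sum_deshuffle_append_singleton a (fun p₁ p₂ => F p₁ (x :: p₂)) w]
    abel

/-- **The derivation `∂ₐ` "remove the final letter if it is `a`"**: `(∂ₐ f)(w) = f(w a)`, i.e.
`∂ₐ(w a) = w`, `∂ₐ(w b) = 0` (`b ≠ a`), `∂ₐ(∅) = 0` on words. [folklore] -/
def dEnd (a : α) : ShuffleAlgebra α R →+ ShuffleAlgebra α R where
  toFun f := ⟨fun w => f (w ++ [a])⟩
  map_zero' := rfl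
  map_add' _ _ := rfl

/-- `(∂ₐ f)(w) = f(w a)`. [folklore] -/
@[simp] theorem dEnd_apply (a : α) (f : ShuffleAlgebra α R) (w : List α) :
    dEnd a f w = f (w ++ [a]) := rfl

/-- `(∂ₐᵏ f)(w) = f(w aᵏ)`. [folklore] -/
theorem dEnd_iterate_apply (a : α) (k : ℕ) (f : ShuffleAlgebra α R) (w : List α) :
    ((dEnd a)^[k] f) w = f (w ++ List.replicate k a) := by
  induction k generalizing w with
  | zero => simp
  | succ k ih =>
    rw [Function.iterate_succ_apply', dEnd_apply, ih, List.append_assoc, List.singleton_append,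
      List.replicate_succ]

/-- **`∂ₐ` is a derivation of the shuffle product.** [folklore] -/
theorem dEnd_mul (a : α) (f g : ShuffleAlgebra α R) :
    dEnd a (f * g) = dEnd a f * g + f * dEnd a g := by
  ext w
  simp only [dEnd_apply, mul_apply, add_apply]
  exact sum_deshuffle_append_singleton a (fun p₁ p₂ => f p₁ * g p₂) w

/-- `∂ₐ (C r) = 0`. [folklore] -/
theorem dEnd_C (a : α) (r : R) : dEnd a (C r : ShuffleAlgebra α R) = 0 := by
  ext w; cases w <;> simp

/-- **The derivation `ᵦ∂` "remove the initial letter if it is `b`"**: `(ᵦ∂ f)(w) = f(b w)`.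
[folklore] -/
def dFront (b : α) : ShuffleAlgebra α R →+ ShuffleAlgebra α R where
  toFun f := ⟨fun w => f (b :: w)⟩
  map_zero' := rfl
  map_add' _ _ := rfl

/-- `(ᵦ∂ f)(w) = f(b w)`. [folklore] -/
@[simp] theorem dFront_apply (b : α) (f : ShuffleAlgebra α R) (w : List α) :
    dFront b f w = f (b :: w) := rfl

/-- `(ᵦ∂ᵏ f)(w) = f(bᵏ w)`. [folklore] -/
theorem dFront_iterate_apply (b : α) (k : ℕ) (f : ShuffleAlgebra α R) (w : List α) :
    ((dFront b)^[k] f) w = f (List.replicate k b ++ w) := by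
  induction k generalizing w with
  | zero => simp
  | succ k ih =>
    rw [Function.iterate_succ_apply', dFront_apply, ih, List.replicate_succ', List.append_assoc,
      List.singleton_append]

/-- **`ᵦ∂` is a derivation of the shuffle product.** [folklore] -/
theorem dFront_mul (b : α) (f g : ShuffleAlgebra α R) :
    dFront b (f * g) = dFront b f * g + f * dFront b g := by
  ext w
  simp only [dFront_apply, mul_apply, add_apply, deshuffle_cons, List.map_append, List.map_map,
    Function.comp_def, List.sum_append]

/-- The value of a product at a non-empty word, through `ᵦ∂`:
`(f ш g)(b w) = (ᵦ∂ f ш g)(w) + (f ш ᵦ∂ g)(w)`. [folklore] -/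
theorem mul_apply_cons (f g : ShuffleAlgebra α R) (b : α) (w : List α) :
    (f * g) (b :: w) = (dFront b f * g) w + (f * dFront b g) w := by
  rw [← add_apply, ← dFront_mul]; rfl

/-- `ᵦ∂ (C r) = 0`. [folklore] -/
theorem dFront_C (b : α) (r : R) : dFront b (C r : ShuffleAlgebra α R) = 0 := by
  ext w; simp

/-! ### Words and the shuffle product of two words -/

/-- Every letter of a shuffle of `u` and `v` is a letter of `u` or of `v`. [folklore] -/
theorem mem_or_mem_of_mem_shuffleWord : ∀ (u v : List α) {w : List α}, w ∈ MZV.shuffleWord u v →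
    ∀ c ∈ w, c ∈ u ∨ c ∈ v
  | [], v, w, hw, c, hc => by
    rw [MZV.shuffleWord_nil_left, List.mem_singleton] at hw
    subst hw; exact Or.inr hc
  | a :: u, [], w, hw, c, hc => by
    rw [MZV.shuffleWord_nil_right, List.mem_singleton] at hw
    subst hw; exact Or.inl hc
  | a :: u, b :: v, w, hw, c, hc => by
    rw [MZV.shuffleWord_cons_cons, List.mem_append, List.mem_map, List.mem_map] at hw
    rcases hw with ⟨w', hw', rfl⟩ | ⟨w', hw', rfl⟩
    · rcases List.mem_cons.1 hc with rfl | hc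
      · exact Or.inl List.mem_cons_self
      · rcases mem_or_mem_of_mem_shuffleWord u (b :: v) hw' c hc with h | h
        · exact Or.inl (List.mem_cons_of_mem a h)
        · exact Or.inr h
    · rcases List.mem_cons.1 hc with rfl | hc
      · exact Or.inr List.mem_cons_self
      · rcases mem_or_mem_of_mem_shuffleWord (a :: u) v hw' c hc with h | h
        · exact Or.inl h
        · exact Or.inr (List.mem_cons_of_mem b h)

variable [DecidableEq α]

/-- The word `w` as an element of the shuffle algebra (coefficient `1` on `w`, `0` elsewhere).
[folklore] -/
def word (w : List α) : ShuffleAlgebra α R := ⟨fun v => if v = w then 1 else 0⟩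

/-- `word w (v) = [v = w]`. [folklore] -/
@[simp] theorem word_apply (w v : List α) :
    (word w : ShuffleAlgebra α R) v = if v = w then 1 else 0 := rfl

/-- The empty word is the unit. [folklore] -/
theorem word_nil : (word ([] : List α) : ShuffleAlgebra α R) = 1 := by
  ext v; cases v <;> simp

/-- `∂ₐ (u a) = u` on words. [folklore] -/
theorem dEnd_word_append (a : α) (u : List α) :
    dEnd a (word (u ++ [a]) : ShuffleAlgebra α R) = word u := by
  ext w; simp

/-- `∂ₐ u = 0` for a word `u` not ending with `a` (including `u = ∅`). [folklore] -/
theorem dEnd_word_of_ne (a : α) {u : List α} (h : u.getLast? ≠ some a) :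
    dEnd a (word u : ShuffleAlgebra α R) = 0 := by
  ext w
  simp only [dEnd_apply, word_apply, zero_apply, ite_eq_right_iff]
  rintro rfl
  simp at h

/-- `ᵦ∂ (b u) = u` on words. [folklore] -/
theorem dFront_word_cons (b : α) (u : List α) :
    dFront b (word (b :: u) : ShuffleAlgebra α R) = word u := by
  ext w; simp

/-- `ᵦ∂ u = 0` for a word `u` not beginning with `b` (including `u = ∅`). [folklore] -/
theorem dFront_word_of_ne (b : α) {u : List α} (h : u.head? ≠ some b) :
    dFront b (word u : ShuffleAlgebra α R) = 0 := by
  ext w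
  simp only [dFront_apply, word_apply, zero_apply, ite_eq_right_iff]
  rintro rfl
  simp at h

/-- A sum of words with the letter `b` prefixed vanishes at `∅` and, at `x w`, equals
`[x = b] · (Σ words)(w)`. [folklore] -/
theorem list_sum_map_word_cons_apply (b : α) (L : List (List α)) (v : List α) :
    ((L.map fun w' => word (b :: w')).sum : ShuffleAlgebra α R) v =
      match v with
      | [] => 0
      | x :: w => if x = b then ((L.map word).sum : ShuffleAlgebra α R) w else 0 := by
  cases v with
  | nil =>
    rw [list_sum_apply, List.map_map]
    exact List.sum_eq_zero fun r hr => by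
      obtain ⟨w', -, rfl⟩ := List.mem_map.1 hr
      simp
  | cons x w =>
    dsimp only
    rw [list_sum_apply, List.map_map]
    by_cases hxb : x = b
    · subst hxb
      rw [if_pos rfl, list_sum_apply, List.map_map]
      exact congrArg List.sum (List.map_congr_left fun w' _ => by simp)
    · rw [if_neg hxb]
      exact List.sum_eq_zero fun r hr => by
        obtain ⟨w', -, rfl⟩ := List.mem_map.1 hr
        simp [hxb]

/-- **The shuffle product of two words is the sum of their shuffles**:
`u ш v = Σ_{w ∈ u ш v} w`, the shuffles listed with multiplicity by `MZV.shuffleWord` (proved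
along the recursion `(a u) ш (b v) = a (u ш b v) + b (a u ш v)`, reading the first letter through
`ᵦ∂`). [cite: Reutenauer1993, §1.4] -/
theorem word_mul_word : ∀ (u v : List α),
    (word u * word v : ShuffleAlgebra α R) = ((MZV.shuffleWord u v).map word).sum
  | [], v => by
    rw [word_nil, one_mul, MZV.shuffleWord_nil_left, List.map_singleton, List.sum_singleton]
  | a :: u, [] => by
    rw [word_nil, mul_one, MZV.shuffleWord_nil_right, List.map_singleton, List.sum_singleton]
  | a :: u, b :: v => by
    ext w
    rw [MZV.shuffleWord_cons_cons, List.map_append, List.sum_append, add_apply, List.map_map,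
      List.map_map, Function.comp_def, Function.comp_def, list_sum_map_word_cons_apply,
      list_sum_map_word_cons_apply]
    cases w with
    | nil => simp [mul_apply]
    | cons x w =>
      dsimp only
      rw [mul_apply_cons, ← word_mul_word u (b :: v), ← word_mul_word (a :: u) v]
      congr 1
      · by_cases hxa : x = a
        · subst hxa; rw [if_pos rfl, dFront_word_cons]
        · rw [if_neg hxa, dFront_word_of_ne x (by simpa using Ne.symm hxa), zero_mul, zero_apply]
      · by_cases hxb : x = b
        · subst hxb; rw [if_pos rfl, dFront_word_cons]
        · rw [if_neg hxb, dFront_word_of_ne x (by simpa using Ne.symm hxb), mul_zero, zero_apply]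

/-- **Divided powers of a letter**: `aⁱ ш aʲ = binom(i+j, i) aⁱ⁺ʲ` (all `binom(i+j,i)` shuffles
of `aⁱ` and `aʲ` are the word `aⁱ⁺ʲ`). [cite: Reutenauer1993, §1.4] -/
theorem word_replicate_mul_word_replicate (a : α) (i j : ℕ) :
    (word (List.replicate i a) * word (List.replicate j a) : ShuffleAlgebra α R) =
      (i + j).choose i • word (List.replicate (i + j) a) := by
  rw [word_mul_word]
  have hall : ∀ w ∈ MZV.shuffleWord (List.replicate i a) (List.replicate j a),
      w = List.replicate (i + j) a := by
    intro w hw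
    rw [List.eq_replicate_iff]
    refine ⟨by simpa using MZV.length_of_mem_shuffleWord _ _ hw, fun c hc => ?_⟩
    rcases mem_or_mem_of_mem_shuffleWord _ _ hw c hc with h | h <;> exact List.eq_of_mem_replicate h
  have hmap : (MZV.shuffleWord (List.replicate i a) (List.replicate j a)).map
      (word : List α → ShuffleAlgebra α R) =
      (MZV.shuffleWord (List.replicate i a) (List.replicate j a)).map
        fun _ => word (List.replicate (i + j) a) :=
    List.map_congr_left fun w hw => by rw [hall w hw]
  rw [hmap, List.map_const', List.sum_replicate, MZV.length_shuffleWord, List.length_replicate,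
    List.length_replicate]

end Ring

end ShuffleAlgebra

/-! ## The Taylor (constant-term) map of a derivation with divided powers

Abstract algebra behind IKZ's regularisation formula [IharaKanekoZagier2006, Cor. 5]: in a
commutative ring `A` with an additive derivation `D` and a sequence `t₀ = 1, t₁, t₂, …` of
"divided powers" (`tᵢ tⱼ = binom(i+j,i) tᵢ₊ⱼ`, `D tₖ₊₁ = tₖ`), the finite sums
`τ_N(f) = Σ_{k<N} (-1)ᵏ tₖ D^k(f)` (`TaylorSystem.taylor`) are, on `D`-nilpotent elements,
MULTIPLICATIVE (`TaylorSystem.taylor_mul`), kill `D` (`TaylorSystem.D_taylor`), fix `ker D`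
(`TaylorSystem.taylor_of_D_eq_zero`) and commute with `ker D`-multiples
(`TaylorSystem.taylor_mul_left_of_D_eq_zero`): `τ` is the "constant term" homomorphism
`f(t) ↦ f(0)` of `A ⊇ (ker D)[t₁]`. In the shuffle algebra with `D = ∂ₓ` (remove a final `x`) and
`tₖ = xᵏ` this is the mirror image of IKZ's `reg`, with `D = ᵧ∂`, `tₖ = yᵏ` it is IKZ's
`reg_ш^T` at `T = 0` (below). -/

/-- A derivation with divided powers on a commutative ring: an additive map `D` with the Leibniz
rule, and elements `t k` (`k ∈ ℕ`) with `t 0 = 1`, `t i * t j = binom(i+j,i) • t (i+j)` and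
`D (t (k+1)) = t k` (e.g. `D = d/dt`, `t k = tᵏ/k!`; here: `D = ∂ₐ`, `t k = aᵏ` in the shuffle
algebra). [folklore] -/
structure TaylorSystem (A : Type*) [CommRing A] where
  /-- The derivation. -/
  D : A →+ A
  /-- The divided powers `t k` ("`tᵏ/k!`"). -/
  t : ℕ → A
  /-- Leibniz rule. -/
  map_mul : ∀ f g, D (f * g) = D f * g + f * D g
  /-- `t 0 = 1`. -/
  t_zero : t 0 = 1
  /-- Divided-power multiplication. -/
  t_mul : ∀ i j, t i * t j = (i + j).choose i • t (i + j)
  /-- `D` lowers divided powers. -/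
  D_t_succ : ∀ k, D (t (k + 1)) = t k

namespace TaylorSystem

variable {A : Type*} [CommRing A] (T : TaylorSystem A)

/-- **The Taylor (constant-term) map** `τ_N(f) = Σ_{k<N} (-1)ᵏ tₖ Dᵏ(f)` (to be used with
`D^N f = 0`). [cite: IharaKanekoZagier2006, Cor. 5] -/
def taylor (N : ℕ) (f : A) : A :=
  ∑ k ∈ Finset.range N, (-1) ^ k * (T.t k * (T.D^[k] f))

/-- `D 1 = 0`. [folklore] -/
theorem D_one : T.D 1 = 0 := by
  have h := T.map_mul 1 1
  rw [one_mul, mul_one, one_mul] at h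
  -- h : D 1 = D 1 + D 1
  have : T.D 1 + T.D 1 - T.D 1 = T.D 1 - T.D 1 := by rw [← h]
  simpa using this

/-- If `D^n f = 0` then `D^m f = 0` for all `m ≥ n`. [folklore] -/
theorem iterate_eq_zero_of_le {n m : ℕ} {f : A} (hf : T.D^[n] f = 0) (h : n ≤ m) : T.D^[m] f = 0 := by
  obtain ⟨d, rfl⟩ := Nat.exists_eq_add_of_le h
  rw [add_comm, Function.iterate_add_apply, hf, iterate_map_zero]

/-- **General Leibniz rule**: `Dⁿ(f g) = Σ_{i+j=n} binom(n,i) Dⁱf Dʲg`. [folklore] -/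
theorem iterate_mul (n : ℕ) (f g : A) :
    T.D^[n] (f * g) =
      ∑ p ∈ Finset.HasAntidiagonal.antidiagonal n, n.choose p.1 • (T.D^[p.1] f * T.D^[p.2] g) := by
  induction n with
  | zero => simp
  | succ n ih =>
    rw [Finset.sum_antidiagonal_choose_succ_nsmul (fun i j => T.D^[i] f * T.D^[j] g) n,
      Function.iterate_succ_apply', ih, map_sum]
    simp only [map_nsmul, T.map_mul, smul_add, Finset.sum_add_distrib,
      Function.iterate_succ_apply']
    rw [add_comm]
    congr 1
    refine Finset.sum_congr rfl fun p hp => ?_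
    rw [Nat.choose_symm_of_eq_add (Finset.HasAntidiagonal.mem_antidiagonal.1 hp).symm]

/-- Enlarging `N` beyond the nilpotency index does not change `τ_N(f)`. [folklore] -/
theorem taylor_eq_of_le {N N' : ℕ} {f : A} (hf : T.D^[N] f = 0) (h : N ≤ N') :
    T.taylor N' f = T.taylor N f := by
  induction N', h using Nat.le_induction with
  | base => rfl
  | succ N' hNN' ih =>
    rw [taylor, Finset.sum_range_succ, ← taylor, ih, T.iterate_eq_zero_of_le hf hNN', mul_zero,
      mul_zero, add_zero]

/-- `τ_N` is additive. [folklore] -/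
theorem taylor_add (N : ℕ) (f g : A) : T.taylor N (f + g) = T.taylor N f + T.taylor N g := by
  simp only [taylor, iterate_map_add, mul_add, Finset.sum_add_distrib]

/-- `τ_N` of a finite sum. [folklore] -/
theorem taylor_sum {ι : Type*} (N : ℕ) (s : Finset ι) (f : ι → A) :
    T.taylor N (∑ i ∈ s, f i) = ∑ i ∈ s, T.taylor N (f i) := by
  classical
  induction s using Finset.induction_on with
  | empty => simp [taylor]
  | insert i s hi ih => rw [Finset.sum_insert hi, Finset.sum_insert hi, taylor_add, ih]

/-- `τ_N` of a list sum. [folklore] -/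
theorem taylor_list_sum {ι : Type*} (N : ℕ) (L : List ι) (f : ι → A) :
    T.taylor N (L.map f).sum = (L.map fun i => T.taylor N (f i)).sum := by
  induction L with
  | nil => simp [taylor]
  | cons i L ih => rw [List.map_cons, List.sum_cons, List.map_cons, List.sum_cons, taylor_add, ih]

/-- `τ_N(-f) = -τ_N(f)`. [folklore] -/
theorem taylor_neg (N : ℕ) (f : A) : T.taylor N (-f) = -T.taylor N f := by
  simp only [taylor, iterate_map_neg, mul_neg, Finset.sum_neg_distrib]

/-- Elements of `ker D` pass through `Dᵏ`: `Dᵏ(g f) = g Dᵏ f` if `D g = 0`. [folklore] -/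
theorem iterate_mul_left_of_D_eq_zero {g : A} (hg : T.D g = 0) (k : ℕ) (f : A) :
    T.D^[k] (g * f) = g * T.D^[k] f := by
  induction k with
  | zero => rfl
  | succ k ih => rw [Function.iterate_succ_apply', ih, T.map_mul, hg, zero_mul, zero_add,
      Function.iterate_succ_apply']

/-- **`τ_N` is `ker D`-linear**: `τ_N(g f) = g τ_N(f)` if `D g = 0`. [folklore] -/
theorem taylor_mul_left_of_D_eq_zero {g : A} (hg : T.D g = 0) (N : ℕ) (f : A) :
    T.taylor N (g * f) = g * T.taylor N f := by
  simp only [taylor, T.iterate_mul_left_of_D_eq_zero hg, Finset.mul_sum]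
  exact Finset.sum_congr rfl fun k _ => by ring

/-- **`τ_N` is the identity on `ker D`** (`N ≥ 1`). [folklore] -/
theorem taylor_of_D_eq_zero {f : A} (hf : T.D f = 0) {N : ℕ} (hN : 1 ≤ N) : T.taylor N f = f := by
  rw [T.taylor_eq_of_le (N := 1) (by simpa using hf) hN]
  simp [taylor, T.t_zero]

/-- The derivative of a Taylor sum telescopes: `D(τ_{n+1} f) = (-1)ⁿ tₙ Dⁿ⁺¹ f`. [folklore] -/
theorem D_taylor_succ (f : A) : ∀ n : ℕ, T.D (T.taylor (n + 1) f) = (-1) ^ n * (T.t n * T.D^[n + 1] f)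
  | 0 => by
    simp [taylor, T.t_zero]
  | n + 1 => by
    rw [taylor, Finset.sum_range_succ, ← taylor, map_add, D_taylor_succ f n]
    have h2 : T.D ((-1) ^ (n + 1) * (T.t (n + 1) * T.D^[n + 1] f)) =
        (-1) ^ (n + 1) * (T.t n * T.D^[n + 1] f + T.t (n + 1) * T.D^[n + 1 + 1] f) := by
      have hc : T.D ((-1) ^ (n + 1) : A) = 0 := by
        rcases neg_one_pow_eq_or A (n + 1) with h | h <;> rw [h]
        · exact T.D_one
        · rw [map_neg, T.D_one, neg_zero]
      rw [T.map_mul, hc, zero_mul, zero_add, T.map_mul, T.D_t_succ,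
        Function.iterate_succ_apply' _ (n + 1)]
    rw [h2, pow_succ]
    ring

/-- **`τ` kills `D`**: `D(τ_N f) = 0` whenever `D^N f = 0`. [folklore] -/
theorem D_taylor {N : ℕ} {f : A} (hf : T.D^[N] f = 0) : T.D (T.taylor N f) = 0 := by
  cases N with
  | zero => simp [taylor]
  | succ n => rw [D_taylor_succ, hf, mul_zero, mul_zero]

/-- Reindexing a triangular double sum whose terms vanish beyond the diagonal. [folklore] -/
theorem sum_range_antidiagonal_eq_sum_range_range {M : Type*} [AddCommMonoid M] (K : ℕ)
    (ψ : ℕ × ℕ → M) (hψ : ∀ p : ℕ × ℕ, K ≤ p.1 + p.2 → ψ p = 0) :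
    ∑ k ∈ Finset.range K, ∑ p ∈ Finset.HasAntidiagonal.antidiagonal k, ψ p =
      ∑ i ∈ Finset.range K, ∑ j ∈ Finset.range K, ψ (i, j) := by
  rw [← Finset.sum_product (s := Finset.range K) (t := Finset.range K) (f := ψ)]
  set S := (Finset.range K ×ˢ Finset.range K).filter fun p : ℕ × ℕ => p.1 + p.2 < K with hS
  have h1 : ∑ p ∈ Finset.range K ×ˢ Finset.range K, ψ p = ∑ p ∈ S, ψ p := by
    rw [← Finset.sum_filter_add_sum_filter_not (Finset.range K ×ˢ Finset.range K)
      (fun p : ℕ × ℕ => p.1 + p.2 < K) ψ, ← hS]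
    have h0 : ∑ p ∈ (Finset.range K ×ˢ Finset.range K).filter (fun p : ℕ × ℕ => ¬ p.1 + p.2 < K),
        ψ p = 0 :=
      Finset.sum_eq_zero fun p hp => hψ p (by rw [Finset.mem_filter] at hp; exact not_lt.1 hp.2)
    rw [h0, add_zero]
  rw [h1, ← Finset.sum_fiberwise_of_maps_to (s := S) (t := Finset.range K)
    (g := fun p : ℕ × ℕ => p.1 + p.2) (fun p hp => by
      rw [Finset.mem_range]; rw [hS, Finset.mem_filter] at hp; exact hp.2)]
  refine Finset.sum_congr rfl fun k hk => Finset.sum_congr ?_ fun _ _ => rfl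
  ext ⟨i, j⟩
  rw [Finset.mem_range] at hk
  simp only [Finset.HasAntidiagonal.mem_antidiagonal, hS, Finset.mem_filter, Finset.mem_product,
    Finset.mem_range]
  omega

/-- **The Taylor map is multiplicative** on nilpotent elements: if `D^N f = 0` and `D^M g = 0`
then `τ_{N+M}(f g) = τ_N(f) τ_M(g)` (and `D^{N+M}(fg) = 0`). This is the algebra behind
"reg_ш is an algebra homomorphism" [IharaKanekoZagier2006, §3, Prop. 1 and Cor. 5]. [folklore] -/
theorem taylor_mul {N M : ℕ} {f g : A} (hf : T.D^[N] f = 0) (hg : T.D^[M] g = 0) :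
    T.taylor (N + M) (f * g) = T.taylor N f * T.taylor M g := by
  set K := N + M with hK
  -- the common value: `Σ_{i<K} Σ_{j<K} ψ (i, j)`
  let ψ : ℕ × ℕ → A := fun p =>
    (-1) ^ (p.1 + p.2) * ((T.t p.1 * T.t p.2) * (T.D^[p.1] f * T.D^[p.2] g))
  have hψ : ∀ p : ℕ × ℕ, K ≤ p.1 + p.2 → ψ p = 0 := by
    rintro ⟨i, j⟩ hij
    simp only [ψ]
    rcases le_or_gt N i with hi | hi
    · rw [T.iterate_eq_zero_of_le hf hi, zero_mul, mul_zero, mul_zero]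
    · have hj : M ≤ j := by omega
      rw [T.iterate_eq_zero_of_le hg hj, mul_zero, mul_zero, mul_zero]
  have lhs : T.taylor K (f * g) =
      ∑ k ∈ Finset.range K, ∑ p ∈ Finset.HasAntidiagonal.antidiagonal k, ψ p := by
    simp only [taylor, T.iterate_mul, Finset.mul_sum]
    refine Finset.sum_congr rfl fun k _ => Finset.sum_congr rfl fun p hp => ?_
    have hk : p.1 + p.2 = k := Finset.HasAntidiagonal.mem_antidiagonal.1 hp
    simp only [ψ]
    rw [T.t_mul, hk, nsmul_eq_mul, nsmul_eq_mul]
    ring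
  have rhs : T.taylor N f * T.taylor M g = ∑ i ∈ Finset.range K, ∑ j ∈ Finset.range K, ψ (i, j) := by
    rw [← T.taylor_eq_of_le hf (Nat.le_add_right N M), ← T.taylor_eq_of_le hg (Nat.le_add_left M N),
      ← hK, taylor, taylor, Finset.sum_mul_sum]
    refine Finset.sum_congr rfl fun i _ => Finset.sum_congr rfl fun j _ => ?_
    simp only [ψ, pow_add]
    ring
  rw [lhs, rhs, sum_range_antidiagonal_eq_sum_range_range K ψ hψ]

end TaylorSystem

namespace ShuffleAlgebra

section Systems

variable {α : Type u} {R : Type v} [CommRing R]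

/-- The constants form a ring homomorphism `R → (completed shuffle algebra)`. [folklore] -/
def CHom : R →+* ShuffleAlgebra α R where
  toFun := C
  map_one' := C_one
  map_mul' := C_mul
  map_zero' := by ext w; cases w <;> rfl
  map_add' r s := by ext w; cases w <;> simp

/-- `CHom r = C r`. [folklore] -/
@[simp] theorem CHom_apply (r : R) : (CHom r : ShuffleAlgebra α R) = C r := rfl

/-- `((-1)ᵏ f)(w) = (-1)ᵏ f(w)`. [folklore] -/
theorem neg_one_pow_mul_apply (k : ℕ) (f : ShuffleAlgebra α R) (w : List α) :
    ((-1) ^ k * f : ShuffleAlgebra α R) w = (-1) ^ k * f w := by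
  have h : ((-1 : ShuffleAlgebra α R) ^ k) = C ((-1) ^ k) := by
    rw [← CHom_apply, map_pow, map_neg, map_one]
  rw [h, C_mul_apply]

variable [DecidableEq α]

/-- **The Taylor system `(∂ₐ, aᵏ)`** on the completed shuffle algebra: `∂ₐ` removes a final letter
`a`, the divided powers are the words `aᵏ` (`aⁱ ш aʲ = binom(i+j,i) aⁱ⁺ʲ`, `∂ₐ aᵏ⁺¹ = aᵏ`). Its
Taylor map is the constant-term map in the final letter `a` (IKZ's regularisation formula, mirror
image). [cite: IharaKanekoZagier2006, Cor. 5] -/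
def endSystem (a : α) : TaylorSystem (ShuffleAlgebra α R) where
  D := dEnd a
  t k := word (List.replicate k a)
  map_mul := dEnd_mul a
  t_zero := word_nil
  t_mul := word_replicate_mul_word_replicate a
  D_t_succ k := by
    change dEnd a (word (List.replicate (k + 1) a)) = word (List.replicate k a)
    rw [List.replicate_succ']
    exact dEnd_word_append a _

/-- **The Taylor system `(ᵦ∂, bᵏ)`**: `ᵦ∂` removes an initial letter `b`, divided powers `bᵏ`. Its
Taylor map is IKZ's `reg_ш^T` at `T = 0` in the initial letter `b = y`
[IharaKanekoZagier2006, §3, Cor. 5]. [cite: IharaKanekoZagier2006, Cor. 5] -/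
def frontSystem (b : α) : TaylorSystem (ShuffleAlgebra α R) where
  D := dFront b
  t k := word (List.replicate k b)
  map_mul := dFront_mul b
  t_zero := word_nil
  t_mul := word_replicate_mul_word_replicate b
  D_t_succ k := dFront_word_cons b (List.replicate k b)

/-- `(endSystem a).D = ∂ₐ`. [folklore] -/
@[simp] theorem endSystem_D (a : α) : (endSystem a : TaylorSystem (ShuffleAlgebra α R)).D = dEnd a :=
  rfl

/-- `(endSystem a).t k = aᵏ`. [folklore] -/
@[simp] theorem endSystem_t (a : α) (k : ℕ) :
    (endSystem a : TaylorSystem (ShuffleAlgebra α R)).t k = word (List.replicate k a) := rfl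

/-- `(frontSystem b).D = ᵦ∂`. [folklore] -/
@[simp] theorem frontSystem_D (b : α) :
    (frontSystem b : TaylorSystem (ShuffleAlgebra α R)).D = dFront b := rfl

/-- `(frontSystem b).t k = bᵏ`. [folklore] -/
@[simp] theorem frontSystem_t (b : α) (k : ℕ) :
    (frontSystem b : TaylorSystem (ShuffleAlgebra α R)).t k = word (List.replicate k b) := rfl

/-! ### Length bounds ("`f` vanishes on words longer than `n`") and nilpotency -/

/-- A word vanishes on longer words. [folklore] -/
theorem word_apply_eq_zero_of_length_lt (w : List α) :
    ∀ v : List α, w.length < v.length → (word w : ShuffleAlgebra α R) v = 0 := by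
  intro v hv
  rw [word_apply, if_neg]
  rintro rfl
  exact lt_irrefl _ hv

omit [DecidableEq α] in
/-- If `f` vanishes on words longer than `n` then `∂ₐⁿ⁺¹ f = 0`. [folklore] -/
theorem dEnd_iterate_eq_zero (a : α) {n : ℕ} {f : ShuffleAlgebra α R}
    (hf : ∀ v : List α, n < v.length → f v = 0) : (dEnd a)^[n + 1] f = 0 := by
  ext v
  rw [dEnd_iterate_apply, zero_apply]
  exact hf _ (by simp; omega)

omit [DecidableEq α] in
/-- If `f` vanishes on words longer than `n` then `ᵦ∂ⁿ⁺¹ f = 0`. [folklore] -/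
theorem dFront_iterate_eq_zero (b : α) {n : ℕ} {f : ShuffleAlgebra α R}
    (hf : ∀ v : List α, n < v.length → f v = 0) : (dFront b)^[n + 1] f = 0 := by
  ext v
  rw [dFront_iterate_apply, zero_apply]
  exact hf _ (by simp; omega)

/-- `∂ₐ^{|w|+1} w = 0`. [folklore] -/
theorem dEnd_iterate_word_eq_zero (a : α) (w : List α) :
    (dEnd a)^[w.length + 1] (word w : ShuffleAlgebra α R) = 0 :=
  dEnd_iterate_eq_zero a (word_apply_eq_zero_of_length_lt w)

/-- `ᵦ∂^{|w|+1} w = 0`. [folklore] -/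
theorem dFront_iterate_word_eq_zero (b : α) (w : List α) :
    (dFront b)^[w.length + 1] (word w : ShuffleAlgebra α R) = 0 :=
  dFront_iterate_eq_zero b (word_apply_eq_zero_of_length_lt w)

/-- The terms of the end Taylor sum preserve the length bound. [folklore] -/
theorem word_replicate_mul_dEnd_iterate_apply_eq_zero (a : α) {n : ℕ} {f : ShuffleAlgebra α R}
    (hf : ∀ v : List α, n < v.length → f v = 0) (k : ℕ) :
    ∀ v : List α, n < v.length →
      (word (List.replicate k a) * (dEnd a)^[k] f : ShuffleAlgebra α R) v = 0 := by
  intro v hv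
  rw [mul_apply]
  refine List.sum_eq_zero fun r hr => ?_
  obtain ⟨p, hp, rfl⟩ := List.mem_map.1 hr
  simp only [word_apply, dEnd_iterate_apply]
  split_ifs with h
  · rw [one_mul]
    apply hf
    have hl := NCSeries.length_add_length_of_mem_deshuffle v hp
    rw [h, List.length_replicate] at hl
    rw [List.length_append, List.length_replicate]
    omega
  · rw [zero_mul]

/-- The terms of the front Taylor sum preserve the length bound. [folklore] -/
theorem word_replicate_mul_dFront_iterate_apply_eq_zero (b : α) {n : ℕ} {f : ShuffleAlgebra α R}
    (hf : ∀ v : List α, n < v.length → f v = 0) (k : ℕ) :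
    ∀ v : List α, n < v.length →
      (word (List.replicate k b) * (dFront b)^[k] f : ShuffleAlgebra α R) v = 0 := by
  intro v hv
  rw [mul_apply]
  refine List.sum_eq_zero fun r hr => ?_
  obtain ⟨p, hp, rfl⟩ := List.mem_map.1 hr
  simp only [word_apply, dFront_iterate_apply]
  split_ifs with h
  · rw [one_mul]
    apply hf
    have hl := NCSeries.length_add_length_of_mem_deshuffle v hp
    rw [h, List.length_replicate] at hl
    rw [List.length_append, List.length_replicate]
    omega
  · rw [zero_mul]

/-- **The end Taylor map preserves the length bound.** [folklore] -/
theorem endTaylor_apply_eq_zero (a : α) {n : ℕ} {f : ShuffleAlgebra α R}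
    (hf : ∀ v : List α, n < v.length → f v = 0) (N : ℕ) :
    ∀ v : List α, n < v.length → (endSystem a).taylor N f v = 0 := by
  intro v hv
  rw [TaylorSystem.taylor, finset_sum_apply]
  refine Finset.sum_eq_zero fun k _ => ?_
  rw [neg_one_pow_mul_apply, endSystem_t, endSystem_D,
    word_replicate_mul_dEnd_iterate_apply_eq_zero a hf k v hv, mul_zero]

/-- **The front Taylor map preserves the length bound.** [folklore] -/
theorem frontTaylor_apply_eq_zero (b : α) {n : ℕ} {f : ShuffleAlgebra α R}
    (hf : ∀ v : List α, n < v.length → f v = 0) (N : ℕ) :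
    ∀ v : List α, n < v.length → (frontSystem b).taylor N f v = 0 := by
  intro v hv
  rw [TaylorSystem.taylor, finset_sum_apply]
  refine Finset.sum_eq_zero fun k _ => ?_
  rw [neg_one_pow_mul_apply, frontSystem_t, frontSystem_D,
    word_replicate_mul_dFront_iterate_apply_eq_zero b hf k v hv, mul_zero]

/-! ### What the Taylor maps kill -/

/-- **After the end Taylor map no word ending in `a` survives** (`∂ₐ ∘ τ = 0`). [folklore] -/
theorem endTaylor_apply_append (a : α) {N : ℕ} {f : ShuffleAlgebra α R} (hf : (dEnd a)^[N] f = 0)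
    (v : List α) : (endSystem a).taylor N f (v ++ [a]) = 0 := by
  have h := (endSystem a).D_taylor (f := f) (N := N) hf
  rw [endSystem_D] at h
  have h' := DFunLike.congr_fun h v
  rwa [dEnd_apply, zero_apply] at h'

/-- **After the front Taylor map no word beginning with `b` survives** (`ᵦ∂ ∘ τ = 0`). [folklore] -/
theorem frontTaylor_apply_cons (b : α) {N : ℕ} {f : ShuffleAlgebra α R} (hf : (dFront b)^[N] f = 0)
    (v : List α) : (frontSystem b).taylor N f (b :: v) = 0 := by
  have h := (frontSystem b).D_taylor (f := f) (N := N) hf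
  rw [frontSystem_D] at h
  have h' := DFunLike.congr_fun h v
  rwa [dFront_apply, zero_apply] at h'

omit [DecidableEq α] in
/-- A word ending in `a` is not a power of a different letter `b`. [folklore] -/
theorem append_singleton_ne_replicate {a b : α} (hab : a ≠ b) (u : List α) (k : ℕ) :
    u ++ [a] ≠ List.replicate k b := by
  intro h
  have : a ∈ List.replicate k b := by rw [← h]; simp
  exact hab (List.eq_of_mem_replicate this)

/-- **The front Taylor map preserves "no word ending in `a`"** (`a ≠ b`): if `f` vanishes on all
words `v a` then so does `τ_front(f)`. [folklore] -/
theorem frontTaylor_apply_append_eq_zero {a b : α} (hab : a ≠ b) {f : ShuffleAlgebra α R}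
    (hf : ∀ v : List α, f (v ++ [a]) = 0) (N : ℕ) (v : List α) :
    (frontSystem b).taylor N f (v ++ [a]) = 0 := by
  rw [TaylorSystem.taylor, finset_sum_apply]
  refine Finset.sum_eq_zero fun k _ => ?_
  rw [neg_one_pow_mul_apply, frontSystem_t, frontSystem_D, mul_apply,
    sum_deshuffle_append_singleton a
      (fun p₁ p₂ => (word (List.replicate k b) : ShuffleAlgebra α R) p₁ * ((dFront b)^[k] f) p₂) v]
  have h1 : ((NCSeries.deshuffle v).map fun p =>
      (word (List.replicate k b) : ShuffleAlgebra α R) (p.1 ++ [a]) * ((dFront b)^[k] f) p.2).sum = 0 :=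
    List.sum_eq_zero fun r hr => by
      obtain ⟨p, -, rfl⟩ := List.mem_map.1 hr
      rw [word_apply, if_neg (append_singleton_ne_replicate hab p.1 k), zero_mul]
  have h2 : ((NCSeries.deshuffle v).map fun p =>
      (word (List.replicate k b) : ShuffleAlgebra α R) p.1 * ((dFront b)^[k] f) (p.2 ++ [a])).sum = 0 :=
    List.sum_eq_zero fun r hr => by
      obtain ⟨p, -, rfl⟩ := List.mem_map.1 hr
      rw [dFront_iterate_apply, ← List.append_assoc, hf, mul_zero]
  rw [h1, h2, add_zero, mul_zero]

end Systems

end ShuffleAlgebra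

/-! ## IKZ's shuffle regularisation of binary words is the two-sided Taylor map

Alphabet `Bool` (`false = x`, `true = y`, as in `MZVShuffleRegularisation.lean`), coefficients `ℚ`.
-/

namespace ShuffleAlgebra

section Reg

open MZV

/-- **The end regularisation of a word** as an element of the completed shuffle algebra:
`τ^{end}_{|w|+1}(w) = Σ_k (-1)ᵏ xᵏ ш ∂ₓᵏ(w)`; equals the tree's `MZV.regEnd w`
(`ShuffleAlgebra.regEnd_apply`). [cite: IharaKanekoZagier2006, Cor. 5] -/
def regE (w : List Bool) : ShuffleAlgebra Bool ℚ :=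
  (endSystem false).taylor (w.length + 1) (word w)

/-- **The front regularisation of a word**: `τ^{front}_{|w|+1}(w) = Σ_i (-1)ⁱ yⁱ ш ᵧ∂ⁱ(w)`;
equals the tree's `MZV.regFront w` (`ShuffleAlgebra.regFront_apply`).
[cite: IharaKanekoZagier2006, Cor. 5] -/
def regF (w : List Bool) : ShuffleAlgebra Bool ℚ :=
  (frontSystem true).taylor (w.length + 1) (word w)

/-- **The two-sided regularisation of a word** `reg(w) = τ^{front}(τ^{end}(w))`; equals the tree's
`MZV.shuffleReg w` (`ShuffleAlgebra.shuffleReg_apply`).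
[cite: IharaKanekoZagier2006, §3 (reg_ш) and Cor. 5] -/
def reg (w : List Bool) : ShuffleAlgebra Bool ℚ :=
  (frontSystem true).taylor (w.length + 1) (regE w)

/-- `regE w` vanishes on words longer than `w`. [folklore] -/
theorem regE_apply_eq_zero_of_length_lt (w : List Bool) :
    ∀ v : List Bool, w.length < v.length → regE w v = 0 :=
  endTaylor_apply_eq_zero false (word_apply_eq_zero_of_length_lt w) _

/-- `regF w` vanishes on words longer than `w`. [folklore] -/
theorem regF_apply_eq_zero_of_length_lt (w : List Bool) :
    ∀ v : List Bool, w.length < v.length → regF w v = 0 :=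
  frontTaylor_apply_eq_zero true (word_apply_eq_zero_of_length_lt w) _

/-- `reg w` vanishes on words longer than `w`. [folklore] -/
theorem reg_apply_eq_zero_of_length_lt (w : List Bool) :
    ∀ v : List Bool, w.length < v.length → reg w v = 0 :=
  frontTaylor_apply_eq_zero true (regE_apply_eq_zero_of_length_lt w) _

/-- `ᵧ∂^{|w|+1} (regE w) = 0`. [folklore] -/
theorem dFront_iterate_regE_eq_zero (w : List Bool) :
    (dFront true)^[w.length + 1] (regE w) = 0 :=
  dFront_iterate_eq_zero true (regE_apply_eq_zero_of_length_lt w)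

/-- **`reg` is a homomorphism for the shuffle product**: `Σ_{w ∈ u ш v} reg(w) = reg(u) ш reg(v)`
("`reg_ш` … is an algebra homomorphism", [IharaKanekoZagier2006, §3 p. 314]; here derived for the
explicit formula of Cor. 5 from `TaylorSystem.taylor_mul`).
[cite: IharaKanekoZagier2006, §3, Prop. 1 and Cor. 5] -/
theorem reg_mul (u v : List Bool) : ((MZV.shuffleWord u v).map reg).sum = reg u * reg v := by
  have hu := dFront_iterate_regE_eq_zero u
  have hv := dFront_iterate_regE_eq_zero v
  rw [reg, reg, ← (frontSystem true).taylor_mul hu hv, regE, regE,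
    ← (endSystem false).taylor_mul (dEnd_iterate_word_eq_zero false u)
      (dEnd_iterate_word_eq_zero false v),
    word_mul_word, TaylorSystem.taylor_list_sum, TaylorSystem.taylor_list_sum]
  refine congrArg List.sum (List.map_congr_left fun w hw => ?_)
  have hl : w.length = u.length + v.length := MZV.length_of_mem_shuffleWord u v hw
  have hK : w.length + 1 ≤ u.length + 1 + (v.length + 1) := by omega
  have hEw := dEnd_iterate_word_eq_zero (R := ℚ) false w
  have hFw := dFront_iterate_regE_eq_zero w
  rw [regE] at hFw
  unfold reg regE
  rw [(endSystem false).taylor_eq_of_le hEw hK, (frontSystem true).taylor_eq_of_le hFw hK]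

/-- `regE w` vanishes on words ending in `x`. [folklore] -/
theorem regE_apply_append_false (w v : List Bool) : regE w (v ++ [false]) = 0 :=
  endTaylor_apply_append false (dEnd_iterate_word_eq_zero false w) v

/-- **`reg w` vanishes on words ending in `x`.**
[cite: IharaKanekoZagier2006, §3 p. 314 (reg_ш maps into 𝔥⁰)] -/
theorem reg_apply_append_false (w v : List Bool) : reg w (v ++ [false]) = 0 :=
  frontTaylor_apply_append_eq_zero (a := false) (b := true) (by decide)
    (regE_apply_append_false w) _ v

/-- **`reg w` vanishes on words beginning with `y`.**
[cite: IharaKanekoZagier2006, §3 p. 314 (reg_ш maps into 𝔥⁰)] -/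
theorem reg_apply_cons_true (w v : List Bool) : reg w (true :: v) = 0 :=
  frontTaylor_apply_cons true (dFront_iterate_regE_eq_zero w) v

end Reg

end ShuffleAlgebra

end Literature.NumberTheory.Transcendental
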